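import Summits.QuantumFields.BalabanUV.T4Continuum.Support.DirichletScalarTowerBox

/-!
# T⁴ programme, spine node NE2 (U1a), sub-row Δ1 «NE2⁰-Dirichlet» — THE LEVEL ADAPTER: a two-level bound for the Ω-compressed scalar tower
# stated by a SUPPLIER at level `N = n_k` in road P2's spelling (`blockReg n_k M S`, `refineR n_k L M …`) becomes the owner's binder
# `hinjS` of `Support/DirichletScalarTower` at every level, hence `FreeTowerLaws` / `TowerLimitRate` — for ANY set `S` of unit blocks and
# ANY level-indexed majorant; the `√R/√N` (Besov) and `C₁θ^k` shapes pre-wired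

Twelfth generation of the NE2 prover lineage P1 of the cell `pub-balaban` (row NE2 owner), file 5 (owner ruling R22's interface item).  After
`Support/DirichletScalarTowerBox` (the box END, rate `L⁻¹`), two supplier lines attack GENERAL unions of unit blocks at weaker geometric rates:
unit b2b-balaban-gan24-p2 gen 23's SOCKETS `Beta/GAN24/DirichletBoxSockets` ((S1) a full-torus `H²` socket, (S2) level-dependent budgets for
ANY union of blocks) and the NE2 crew's Δ1-BESOV line (leaf-08 gen 3, `Support/DirichletDirectionalBesov` …: one-sided Nirenberg/Savaré
translations ⟹ `‖(D′^{Ω′})⁻¹J^Ω − J^Ω(D^Ω)⁻¹‖ ≤ C·√R/√N` on LOCALLY MONOTONE unions, no convexity).  Both state their ENDs at ONE pair of levels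
`(N, R·N)` for the SYNTACTIC region `blockReg N M S`; the owner's tower (`regS`, `DsR`, `JsR`) spells the level-`k` region as the ITERATED
refinement of `blockReg n₀ M S` — the same set, a different predicate.  This file is the adapter, once and for all:

 * §1 **`injected_regS_le_of_blockReg`**: for ANY `S` and ANY majorant `e : ℕ → ℝ`, a family of two-level bounds in road P2's spelling at the
   levels `N = n_k = L^k`, `R = L` implies the owner's `hinjS` for the tower generated by `blockReg n₀ M S` with the same `e` (spelling transport
   `DirichletScalarTowerBox.norm_defect_le_of_iff` + `regS_blockReg_iff`); hence **`freeTowerLaws_dirichletScalar_of_blockReg_levels`** and, for a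
   geometric majorant `e k ≤ C₁θ^k` with `L⁻¹ ≤ θ < 1`, **`towerLimitRate_dirichletScalar_of_blockReg_rate`**.
 * §2 THE BESOV SHAPE: `Real.sqrt (n_k) = (√L)^k` (`sqrt_lev`), so a supplier bound `≤ C·√L/√(n_k)` (the `√R/√N` display at `R = L`) is
   `≤ C√L·((√L)⁻¹)^k`; **`towerLimitRate_dirichletScalar_of_sqrt_levels (hL : 2 ≤ L)`**: such a family gives `TowerLimitRate` at the geometric rate
   `θ = (√L)⁻¹ ∈ [L⁻¹, 1)` — the consumer of the Δ1-BESOV END, by `exact`.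
 * §3 THE `1/N` SHAPE (consistency): a family `≤ C/n_k` gives rate `L⁻¹` (`towerLimitRate_dirichletScalar_of_inv_levels`); the box END of
   `DirichletScalarTowerBox` is the instance `C = Cbox d L a′` (kernel `example`).

HONEST FRAMING (T4-DAG p. 1).  Pure bookkeeping ([folklore]); `U = 1`, SCALAR layer, ONE region generated by a set of unit blocks, ONE averaging
scale; every analytic input is a DISPLAYED family of two-level bounds (nothing of the suppliers is asserted here); NE2 (U1a) NOT proved; spine
0/9 unchanged; NOT infinite volume, NOT a mass gap, NOT the Clay problem, NOT summit progress.  HONEST DEPENDENCY: continuum YM on T⁴ ⇐ BetaPertH ∧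
nine spine estimates (0/9 proved); BetaPertH ⇐ (D1) ∧ (D4) ∧ CAP+tail; G-an2-4 gates asym, D1 and NE2/3/4.  No `sorry`.
-/

noncomputable section

open scoped BigOperators ComplexConjugate Matrix Matrix.Norms.L2Operator
open Filter Topology

namespace Summit.QuantumFields.BalabanUV.T4Continuum.DirichletScalarTowerLevels

open Literature.MathematicalPhysics.QuantumFieldTheory.Balaban1983to89.B5Prop11Plancherel (Tor fine)
open Literature.MathematicalPhysics.QuantumFieldTheory.Balaban1983to89.B5G183RateUnitTower (lev lev_neZero)
open Summit.QuantumFields.BalabanUV.T4Continuum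
open Summit.QuantumFields.BalabanUV.T4Continuum.CovariantAveragingTower (TowerLimitRate)
open Summit.QuantumFields.BalabanUV.T4Continuum.BalabanAveragedTowerUnit (one_le_lev' cast_lev')
open Summit.QuantumFields.BalabanUV.T4Continuum.BackgroundResolventTower
open Summit.QuantumFields.BalabanUV.T4Continuum.ScalarAveragedPropagator (gammaPs)
open Summit.QuantumFields.BalabanUV.T4Continuum.DirichletScalarTower
open Summit.QuantumFields.BalabanUV.T4Continuum.DirichletScalarTowerBox (norm_defect_le_of_iff regS_blockReg_iff injected_le_box_lev
  Cbox_nonneg)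
open Summit.QuantumFields.BalabanUV.Beta.GAN24.DirichletBoxCompression (DOm JOm refineR)
open Summit.QuantumFields.BalabanUV.Beta.GAN24.DirichletBoxTrace (blockReg)
open Summit.QuantumFields.BalabanUV.Beta.GAN24.DirichletBoxTwoLevel (IsCoordBox Cbox)

variable {d : ℕ} (L : ℕ) [NeZero L] (M : Fin d → ℕ) [hM : ∀ μ, NeZero (M μ)] (a' : ℝ) (S : Tor M → Prop) [DecidablePred S]

/-! ## §1 From road P2's spelling at each level to the owner's `hinjS` -/

/-- **THE ADAPTER**: a family of two-level bounds stated at the levels `(n_k, L·n_k)` for the syntactic block region `blockReg n_k M S`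
(road P2's / the suppliers' spelling) IS the binder `hinjS` of the tower generated by `blockReg n₀ M S`, with the same majorant. [folklore] -/
theorem injected_regS_le_of_blockReg {e : ℕ → ℝ}
    (h : ∀ k, ‖(DOm (L * lev L k) M a' (refineR (lev L k) L M (blockReg (lev L k) M S)))⁻¹ * JOm (lev L k) L M (blockReg (lev L k) M S)
        - JOm (lev L k) L M (blockReg (lev L k) M S) * (DOm (lev L k) M a' (blockReg (lev L k) M S))⁻¹‖ ≤ e k) (k : ℕ) :
    ‖(DsR L M a' (blockReg (lev L 0) M S) (k + 1))⁻¹ * JsR L M (blockReg (lev L 0) M S) k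
        - JsR L M (blockReg (lev L 0) M S) k * (DsR L M a' (blockReg (lev L 0) M S) k)⁻¹‖ ≤ e k :=
  (norm_defect_le_of_iff (lev L k) L M a' (fun x => (regS_blockReg_iff L M S k x).symm)).trans (h k)

/-- hence the scalar Dirichlet free tower laws of the block region of `S`, modulo the supplier's family. [folklore] -/
theorem freeTowerLaws_dirichletScalar_of_blockReg_levels (hd : 0 < d) (ha' : 0 < a') {e : ℕ → ℝ}
    (h : ∀ k, ‖(DOm (L * lev L k) M a' (refineR (lev L k) L M (blockReg (lev L k) M S)))⁻¹ * JOm (lev L k) L M (blockReg (lev L k) M S)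
        - JOm (lev L k) L M (blockReg (lev L k) M S) * (DOm (lev L k) M a' (blockReg (lev L k) M S))⁻¹‖ ≤ e k) :
    FreeTowerLaws (DsR L M a' (blockReg (lev L 0) M S)) (QsR L M (blockReg (lev L 0) M S)) (JsR L M (blockReg (lev L 0) M S))
      (fun _ => 0) ((L : ℝ) ^ d) (fun k => 2 * d * Real.sqrt ((gammaPs d a')⁻¹) * ((L : ℝ)⁻¹) ^ k) e (fun _ => 0) :=
  freeTowerLaws_dirichletScalar_of_injected L M a' (blockReg (lev L 0) M S) hd ha' (injected_regS_le_of_blockReg L M a' S h)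

/-- and, for a GEOMETRIC majorant `C₁θ^k` with `L⁻¹ ≤ θ < 1`, the convergence of the Ω-restricted unit-lattice scalar free covariances at rate
`θ` (the general-rate END of row B8, fed in road P2's spelling). [folklore] -/
theorem towerLimitRate_dirichletScalar_of_blockReg_rate (hd : 0 < d) (ha' : 0 < a') {θ C₁ : ℝ} (hθ : ((L : ℝ)⁻¹) ≤ θ) (hθ1 : θ < 1)
    (h : ∀ k, ‖(DOm (L * lev L k) M a' (refineR (lev L k) L M (blockReg (lev L k) M S)))⁻¹ * JOm (lev L k) L M (blockReg (lev L k) M S)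
        - JOm (lev L k) L M (blockReg (lev L k) M S) * (DOm (lev L k) M a' (blockReg (lev L k) M S))⁻¹‖ ≤ C₁ * θ ^ k) :
    TowerLimitRate (QsR L M (blockReg (lev L 0) M S)) ((L : ℝ) ^ d) (fun k => (DsR L M a' (blockReg (lev L 0) M S) k)⁻¹)
      (Cpert 0 (2 * d * Real.sqrt ((gammaPs d a')⁻¹)) C₁ 0 0 0) θ :=
  towerLimitRate_dirichletScalar_of_injected L M a' (blockReg (lev L 0) M S) hd ha' hθ hθ1 (injected_regS_le_of_blockReg L M a' S h)

/-! ## §2 The Besov shape `√R/√N` -/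

omit [NeZero L] in
/-- `√(n_k) = (√L)^k`. [folklore] -/
theorem sqrt_lev (k : ℕ) : Real.sqrt ((lev L k : ℕ) : ℝ) = Real.sqrt (L : ℝ) ^ k := by
  rw [cast_lev', ← Real.sqrt_sq (pow_nonneg (Real.sqrt_nonneg (L : ℝ)) k), ← pow_mul, mul_comm, pow_mul,
    Real.sq_sqrt (Nat.cast_nonneg L)]

omit [NeZero L] in
/-- `(√L)⁻¹ ≥ L⁻¹` for `L ≥ 1` (real `L ≥ 0` suffices: `√L ≤ L` iff `L ≥ 1`; we use `1 ≤ L`). [folklore] -/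
theorem invL_le_inv_sqrt (hL : 1 ≤ L) : ((L : ℝ)⁻¹) ≤ (Real.sqrt (L : ℝ))⁻¹ := by
  have hL1 : (1 : ℝ) ≤ L := by exact_mod_cast hL
  have hs : 0 < Real.sqrt (L : ℝ) := Real.sqrt_pos.mpr (by linarith)
  refine (inv_le_inv₀ (by linarith) hs).mpr ?_
  calc Real.sqrt (L : ℝ) ≤ Real.sqrt (L : ℝ) * Real.sqrt (L : ℝ) :=
        le_mul_of_one_le_right hs.le (by rwa [Real.one_le_sqrt])
    _ = L := Real.mul_self_sqrt (by linarith)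

omit [NeZero L] in
/-- `(√L)⁻¹ < 1` for `L ≥ 2`. [folklore] -/
theorem inv_sqrt_lt_one (hL : 2 ≤ L) : (Real.sqrt (L : ℝ))⁻¹ < 1 := by
  have hL1 : (1 : ℝ) < L := by exact_mod_cast (lt_of_lt_of_le one_lt_two hL : 1 < L)
  exact inv_lt_one_of_one_lt₀ (by rwa [Real.lt_sqrt zero_le_one, one_pow])

/-- **THE CONSUMER OF THE Δ1-BESOV END** (`L ≥ 2`, `d ≥ 1`, `a′ > 0`): a family of two-level bounds `≤ C·√L/√(n_k)` in road P2's spelling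
(the display `C·√R/√N` at `(N, R) = (n_k, L)`) for the block regions of ANY set `S` of unit blocks gives the convergence of the
Ω-restricted unit-lattice scalar free covariances at the GEOMETRIC rate `θ = (√L)⁻¹`, constant `Cpert 0 (2d√(γ′⁻¹)) (C√L) 0 0 0`. [folklore] -/
theorem towerLimitRate_dirichletScalar_of_sqrt_levels (hL : 2 ≤ L) (hd : 0 < d) (ha' : 0 < a') {C : ℝ}
    (h : ∀ k, ‖(DOm (L * lev L k) M a' (refineR (lev L k) L M (blockReg (lev L k) M S)))⁻¹ * JOm (lev L k) L M (blockReg (lev L k) M S)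
        - JOm (lev L k) L M (blockReg (lev L k) M S) * (DOm (lev L k) M a' (blockReg (lev L k) M S))⁻¹‖
        ≤ C * Real.sqrt (L : ℝ) / Real.sqrt ((lev L k : ℕ) : ℝ)) :
    TowerLimitRate (QsR L M (blockReg (lev L 0) M S)) ((L : ℝ) ^ d) (fun k => (DsR L M a' (blockReg (lev L 0) M S) k)⁻¹)
      (Cpert 0 (2 * d * Real.sqrt ((gammaPs d a')⁻¹)) (C * Real.sqrt (L : ℝ)) 0 0 0) ((Real.sqrt (L : ℝ))⁻¹) := by
  have hL1 : 1 ≤ L := le_trans one_le_two hL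
  refine towerLimitRate_dirichletScalar_of_blockReg_rate L M a' S hd ha' (invL_le_inv_sqrt L hL1) (inv_sqrt_lt_one L hL) fun k => ?_
  have hk := h k
  rw [sqrt_lev, div_eq_mul_inv, ← inv_pow] at hk
  exact hk

/-! ## §3 The `1/N` shape (consistency with the box END) -/

/-- a family `≤ C/n_k` in road P2's spelling gives rate `L⁻¹` (`L ≥ 2`). [folklore] -/
theorem towerLimitRate_dirichletScalar_of_inv_levels (hL : 2 ≤ L) (hd : 0 < d) (ha' : 0 < a') {C : ℝ}
    (h : ∀ k, ‖(DOm (L * lev L k) M a' (refineR (lev L k) L M (blockReg (lev L k) M S)))⁻¹ * JOm (lev L k) L M (blockReg (lev L k) M S)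
        - JOm (lev L k) L M (blockReg (lev L k) M S) * (DOm (lev L k) M a' (blockReg (lev L k) M S))⁻¹‖ ≤ C / ((lev L k : ℕ) : ℝ)) :
    TowerLimitRate (QsR L M (blockReg (lev L 0) M S)) ((L : ℝ) ^ d) (fun k => (DsR L M a' (blockReg (lev L 0) M S) k)⁻¹)
      (Cpert 0 (2 * d * Real.sqrt ((gammaPs d a')⁻¹)) C 0 0 0) ((L : ℝ)⁻¹) := by
  refine towerLimitRate_dirichletScalar_of_blockReg_rate L M a' S hd ha' le_rfl
    (inv_lt_one_of_one_lt₀ (by exact_mod_cast (lt_of_lt_of_le one_lt_two hL : 1 < L))) fun k => ?_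
  have hk := h k
  rw [cast_lev', div_eq_mul_inv, ← inv_pow] at hk
  exact hk

/-- **CONSISTENCY (kernel)**: the box END of `DirichletScalarTowerBox` is the instance `C = Cbox d L a′` of §3's shape — road P2's
`injected_le_box`, read through `DirichletBoxSockets`-style spelling-free bounds, lands on the tower by this adapter. -/
example (hL : 2 ≤ L) (hd : 0 < d) (ha' : 0 < a') (hS : IsCoordBox M S) :
    TowerLimitRate (QsR L M (blockReg (lev L 0) M S)) ((L : ℝ) ^ d) (fun k => (DsR L M a' (blockReg (lev L 0) M S) k)⁻¹)
      (Cpert 0 (2 * d * Real.sqrt ((gammaPs d a')⁻¹)) (Cbox d L a') 0 0 0) ((L : ℝ)⁻¹) :=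
  DirichletScalarTowerBox.towerLimitRate_dirichletScalar_box L M a' S hL hd ha' hS

end Summit.QuantumFields.BalabanUV.T4Continuum.DirichletScalarTowerLevels

end
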